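import Summits.CriticalPhenomena.PercolationContinuityZ3.Theorems.PercNearOneGluingNoHeavyLowerTailSahiCoordinateTwoThirds
import Mathlib.Tactic.Linarith
import Mathlib.Tactic.Ring
import HarnessLib

/-!
# `NoHeavyLowerTail` (crux stmt-CriticalPhenomena-4575), master-family line P2: the two-thirds conjecture (T3) HOLDS at every coordinate REQUIRED by a member

Support file (seat `prim-masterthm-p2`, gen 11; `--supports stmt-CriticalPhenomena-4575`); no definition, no sorry.  Memo SAHI-ROUTE.md §4.34(h).

`SahiCoordinateTwoThirds.TwoThirds` (typed, census-clean, implies Kahn's `C_3`) asks, at every coordinate `e` of every increasing triple, for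
`coordPiece₂(e) + E_3(0-sections) ≥ 0`.  Here: if the third member REQUIRES `e` (`C ∩ {e∈ω}` with `C` free of `e`; `A, B` ARBITRARY), the quantity is
  `ν_A·Cov(B¹,C) + ν_B·Cov(A¹,C) + mC·[m(A¹∩B¹) − m(A⁰∩B⁰)] ≥ 0`
(`twoThirds_quantity_interCoord_eq`, from the closed form `SahiCoordinateChord.coordPiece₂_eq`; the `0`-section of the pinned member is `∅`, so its sectional `E_3`
vanishes) — the `t(1−t)` bracket of master-conj's pinning identity (A) (`Pointwise.sahiE_three_interCoord_eq`).  Hence (T3) at required coordinates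
(`twoThirdsAt_interCoord`).  (At coordinates implied by one member (T3) is census-true but has no local Harris certificate — memo §4.34(h); it is OPEN there.)
HONEST FRAMING: one proved case of a typed conjecture; Kahn's Conjecture 5 / Sahi's `C_3` and (T3∀) remain OPEN.  Axioms standard. [this work]
-/

noncomputable section

open scoped Classical

namespace Summit.CriticalPhenomena.PercolationContinuityZ3.Theorems

namespace SahiCoordinateTwoThirds

open Finset Function
open Literature.Combinatorics.Sahi2008
open Literature.Probability.Percolation.DecisionTree (ind ind_of_mem ind_of_not_mem ind_nonneg)
open SahiCombDisjunct
open SahiCoordinateBernstein (coordPiece₁ coordPiece₂)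

variable {ι : Type} [Fintype ι]

section Pinned

variable (p : ι → unitInterval) (e : ι) (A B C : Set (Set ι)) (hCe : ∀ b : Bool, secAt e b C = C)
include hCe

attribute [local simp] secAt_inter secAt_true_coord secAt_false_coord

/-- **The (T3) quantity at a coordinate required by the third member, in closed form**:
`coordPiece₂(e; A, B, C∩{e∈ω}) + E_3(A⁰, B⁰, ∅) = ν_A·Cov(B¹,C) + ν_B·Cov(A¹,C) + mC·(m(A¹∩B¹) − m(A⁰∩B⁰))`. [this work] -/
theorem twoThirds_quantity_interCoord_eq :
    coordPiece₂ p e ![A, B, C ∩ {ω : Set ι | e ∈ ω}] +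
        sahiE (bernoulliWeight p) 3 ![ind (secAt e false A), ind (secAt e false B), ind (secAt e false (C ∩ {ω : Set ι | e ∈ ω}))] =
      (ex (bernoulliWeight p) (ind (secAt e true A)) - ex (bernoulliWeight p) (ind (secAt e false A))) *
          (ex (bernoulliWeight p) (ind (secAt e true B ∩ C)) - ex (bernoulliWeight p) (ind (secAt e true B)) * ex (bernoulliWeight p) (ind C))
      + (ex (bernoulliWeight p) (ind (secAt e true B)) - ex (bernoulliWeight p) (ind (secAt e false B))) *
          (ex (bernoulliWeight p) (ind (secAt e true A ∩ C)) - ex (bernoulliWeight p) (ind (secAt e true A)) * ex (bernoulliWeight p) (ind C))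
      + ex (bernoulliWeight p) (ind C) *
          (ex (bernoulliWeight p) (ind (secAt e true A ∩ secAt e true B)) - ex (bernoulliWeight p) (ind (secAt e false A ∩ secAt e false B))) := by
  have h1 : secAt e true (C ∩ {ω : Set ι | e ∈ ω}) = C := by simp [hCe]
  have h0 : secAt e false (C ∩ {ω : Set ι | e ∈ ω}) = ∅ := by simp [hCe]
  -- `E_3` with an empty member vanishes
  have hE : sahiE (bernoulliWeight p) 3 ![ind (secAt e false A), ind (secAt e false B), ind (∅ : Set (Set ι))] = 0 := by
    rw [sahiE_three]
    simp only [ind_mul_ind_eq_inter, Set.inter_empty, ex_ind_empty]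
    ring
  rw [SahiCoordinateChord.coordPiece₂_eq, h1, h0, hE]
  simp only [Set.inter_empty, ex_ind_empty]
  ring

/-- **(T3) holds at every coordinate required by a member**: for increasing `A, B` (arbitrary in `e`) and an `e`-free increasing `C`,
`0 ≤ coordPiece₂(e; A, B, C ∩ {e∈ω}) + E_3(0-sections)`. [this work] -/
theorem twoThirdsAt_interCoord (hA : IsUpperSet A) (hB : IsUpperSet B) (hC : IsUpperSet C) :
    0 ≤ coordPiece₂ p e ![A, B, C ∩ {ω : Set ι | e ∈ ω}] +
        sahiE (bernoulliWeight p) 3 ![ind (secAt e false A), ind (secAt e false B), ind (secAt e false (C ∩ {ω : Set ι | e ∈ ω}))] := by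
  rw [twoThirds_quantity_interCoord_eq p e A B C hCe]
  have nA := Pointwise.ex_secAt_true_sub_false_nonneg p e hA
  have nB := Pointwise.ex_secAt_true_sub_false_nonneg p e hB
  have cB := Pointwise.cov_ind_nonneg p (isUpperSet_secAt e true hB) hC
  have cA := Pointwise.cov_ind_nonneg p (isUpperSet_secAt e true hA) hC
  have mC : 0 ≤ ex (bernoulliWeight p) (ind C) := ex_ind_nonneg' p C
  have dAB : 0 ≤ ex (bernoulliWeight p) (ind (secAt e true A ∩ secAt e true B)) -
      ex (bernoulliWeight p) (ind (secAt e false A ∩ secAt e false B)) := by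
    rw [Pointwise.ex_ind_sub_of_subset _ (Set.inter_subset_inter (RigidityAll.secAt_false_subset_secAt_true e hA)
      (RigidityAll.secAt_false_subset_secAt_true e hB))]
    exact ex_ind_nonneg' p _
  have t1 := mul_nonneg nA cB
  have t2 := mul_nonneg nB cA
  have t3 := mul_nonneg mC dAB
  linarith

end Pinned

end SahiCoordinateTwoThirds

end Summit.CriticalPhenomena.PercolationContinuityZ3.Theorems
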